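import Literature.MathematicalPhysics.QuantumFieldTheory.BalabanImbrieJaffe1984to88.BIJ88Vj5610Operator
import Literature.MathematicalPhysics.QuantumFieldTheory.BalabanImbrieJaffe1984to88.BIJ88RemovedFieldBounds286
import Literature.MathematicalPhysics.QuantumFieldTheory.BalabanImbrieJaffe1984to88.BIJ88ScaleSums

/-!
# `BalabanImbrieJaffe1984to88.BIJ88VjSmall287` — T. Bałaban, J. Imbrie, A. Jaffe, *Effective action and cluster properties of the abelian
Higgs model*, Commun. Math. Phys. **114** (1988) 257–315 [BalabanImbrieJaffe1988], Sect. 5.6 p. 287 [PDF 31], the sentence after (5.6.11),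
verbatim: *"The terms in V_j are small (O(e_j^{1−α})), bounded kernels, either alone or applied to D_{ũ_{k+1}} or D*_{ũ_{k+1}}."* — the SIZE
`O(e_j^{1−α})` DERIVED END TO END from the printed inputs on their own rows, for the kernels `M` ((5.6.9)) and `F₂` ((5.6.8)) of which this
seat's `BIJ88Vj5610Operator` (p311248) shows `V_j(Ω)` is built: the exponent of `ũ = exp ie_kη[θ_kH_{k,loc}A^{(k)} + w₁A′]` ((5.6.6)) is bounded
through `|θ_k| ≦ 1` ((5.6.1)), the row sums of `H_{k,loc}` ((2.5)) and of `w₁` ((5.4.7)), `|A^{(k)}| ≦ cp(e_k)` (the small-field restriction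
(5.2.2)/(5.9.1)) and `|A′| ≦ cp(e_k)` ((5.3.1), p. 290), and the conversion to the `j`-th scale — p. 287 *"We have with ζ = L^{−j}, Ã scaled
to the ζ-lattice"*, (5.6.7) `(ie_jζÃ)ⁿ` — is the inequality `e_kη ≦ e_jζ` of the running charge (2.2) (`d ≧ 2`, `j ≦ k`), which turns the
`ζ⁻¹` of the ζ-lattice covariant derivative into the factor `e_j`.

statement-level skeleton of published theorems with citation tags; proofs where landed; nothing here is a claim about the Yang–Mills mass gap

PDF held: `paper:balaban1988-cmp114-bij-abelian-higgs-effective-action` (journal page = PDF page + 256); pp. 287, 290 [PDF 31, 34] read as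
images this session (seat folder `pages/original-p031-x2.png`, `original-p034-x2.png`).

CITATION HEADER (lean-in-tree rule).  Part of the lit-balaban TYPED SKELETON (HOME `run/shared/lean/pub/lit-balaban/`), PHASE-2 proof seat
p31 gen 10 (unit `lit-balaban-p31-g10`; third file of the 2026-08-22T00:11Z TAKING).  WHAT IS REPRODUCED: row `C2.Eq5.6.6-5.6.12` of
`HOME/lit-balaban-r16/ROWS-C2-part2.md` (owner r16), the size clause quoted above, p. 287; inputs quoted: (5.6.6) p. 287 *"ũ_{k+1}ũ =
ũ_{k+1} exp ie_kη[θ_kH_{k,loc}A^{(k)} + w₁A′] = ũ_{k+1}e^{ie_kηÃ}"*, (5.6.7) *"We have with ζ = L^{−j}, Ã scaled to the ζ-lattice, ũ_{k+1}ũ =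
ũ_{k+1}(1 + Σ_{n=1}^∞ (ie_jζÃ)ⁿ/n!)"*, (5.6.8) *"… ũ_{k+1}(Γ^{(l)}_{y,x})φ(x)(1 + Σ_{n=1}^∞ (ie_jζA(Γ^{(l)}_{y,x}))ⁿ/n!)"*, p. 290 *"We have
|A′(b_l)| ≦ cp(e_k)"*, (2.2) p. 260 *"e_k = (L^kε)^{(4−d)/2}e"*, (2.33) *"p(e_k) = |log e_k⁻¹|^p"*.

THE MECHANISM.  The bond phase is scale invariant: `e_kηÃ^η_b = e_jζÃ^ζ_b`, so the exponent of (5.6.7) is `a_b = ie_kηÃ_b` with the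
`η`-frame field `Ã_b = θ_k(b)(H_{k,loc}A^{(k)})(b) + (w₁A′)(b)`.  Row sums `Σ_{b′}|H_{k,loc}(b,b′)| ≦ K₀`, `Σ_{b′}|w₁(b,b′)| ≦ W₀` and the field
bounds `|A^{(k)}| ≦ M`, `|A′| ≦ M′`, `|θ_k| ≦ 1` give `|Ã_b| ≦ K₀M + W₀M′ =: G` (`abs_tildeA_le`), hence `‖a_b‖ ≦ e_kηG` and, along a
contour of `N_Γ` bonds, `‖A(y,x)‖ ≦ e_kηN_ΓG` (`norm_expo_le`, `norm_contourExpo_le`).  This seat's kernel bounds (`BIJ88Vj5610Operator.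
norm_mMat_le`, `norm_f2Mat_le`: `‖F₁(w)‖ ≦ 2‖w‖`) then give `‖M(b,x)‖ ≦ ζ⁻¹·2e_kηG` and `‖F₂(y,x)‖ ≦ |w|·2e_kηN_ΓG`; and the running
charge obeys `e_kη = e_kL^{−k} ≦ e_jL^{−j} = e_jζ` for `j ≦ k`, `d ≧ 2`, `L ≧ 1` (`eK_eta_le_eK_zeta`, from p36's `BIJ88ScaleSums.eK_scale`:
`e_j = e_k(L^{−(4−d)/2})^{k−j} ≧ e_kL^{−(k−j)}`), so `ζ⁻¹e_kη ≦ e_j` and, for the block contours `N_Γ ≦ dL^j = dζ⁻¹`, `e_kηN_Γ ≦ de_j`: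
  `‖M(b,x)‖ ≦ 2e_j(K₀M + W₀M′)`,  `‖F₂(y,x)‖ ≦ 2d|w|e_j(K₀M + W₀M′)`   (`norm_mMat_le_scale`, `norm_f2Mat_le_scale`)
— *"small (O(e_j^{1−α})), bounded kernels"* with `M = cp(e_k)`, `M′ = c′p(e_k)`: `O(e_j·p(e_k))`, and `p(e_k) ≦ p(e_j)` because `e_j ≦ e_k ≦ 1`
(`eK_mono`, `pLog_anti`; `norm_mMat_le_printedScale`), i.e. `O(e_jp(e_j)) = O(e_j^{1−α})` in print's logarithmic scale.

WHAT IS PROVED (0 `sorry`, standard axioms; theorems only, no definitions, no `Prop` facts).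
* §1 `abs_tildeA_le` (`|Ã_b| ≦ K₀M + W₀M′`), `norm_expo_le` (`‖ie_kηÃ_b‖ ≦ e_kηG`), `norm_contourExpo_le` (`‖ie_kηΣ_{b∈Γ}σ_bÃ_b‖ ≦ e_kη|Γ|G`).
* §2 the running charge: `eK_eta_le_eK_zeta` (`e_kL^{−k} ≦ e_jL^{−j}`, `j ≦ k`, `2 ≦ d`, `1 ≦ L`), `eK_mono` (`e_j ≦ e_k`, `d ≦ 4`), `pLog_anti`.
* §3 **`norm_mMat_le_scale`**, **`norm_f2Mat_le_scale`** (the two kernels of `V_j` are `O(e_j·(K₀M + W₀M′))` entrywise), `norm_mMat_le_eK`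
  (the same with `e_k, e_j, η, ζ` the printed `eK … k`, `eK … j`, `L^{−k}`, `L^{−j}`), **`norm_mMat_le_printedScale`** (`≦ 2(K₀c + W₀c′)·e_j·p(e_j)`).
HONEST SCOPE.  The inputs are DISPLAYED hypotheses in the shape of their own rows (row sums of `H_{k,loc}`, `w₁`; `|A^{(k)}| ≦ M`, `|A′| ≦ M′`;
`|θ_k| ≦ 1`; contour length `≦ N_Γ`; the smallness `e_kη(K₀M + W₀M′) ≦ 1`, resp. `·N_Γ ≦ 1`, making `‖F₁(w)‖ ≦ 2‖w‖` applicable); the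
transporters `U`, `u` enter only through `|·| ≦ 1`; the last step `e_jp(e_j) ≦ C_αe_j^{1−α}` of print's `O(e_j^{1−α})` is the reading of the
logarithmic scale (2.33) and is not spelled out; operator (row-sum) norms follow entrywise as in `BIJ88Vj5610Operator.norm_*_mulVec_le` and are
not repeated.  Unit `lit-balaban-p31` (literature-prover-lit-balaban-p31-g10-0), 2026-08-22.  NOT summit progress.
-/

namespace Literature.MathematicalPhysics.QuantumFieldTheory.BalabanImbrieJaffe1984to88.BIJ88VjSmall287

open Literature.MathematicalPhysics.QuantumFieldTheory.Balaban1983to89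
open BIJ88Sect2Statements (eK pLog)
open BIJ88Sect5Statements (F1 norm_F1_le)
open BIJ88Vj5610Operator (mMat f2Mat norm_mMat_le norm_f2Mat_le)
open BIJ88Smooth43Phase (abs_kernel_apply_le)
open BIJ88RemovedFieldBounds286 (abs_mul_le_of_abs_le_one)
open BIJ88ScaleSums (eK_scale eK_pos)
open scoped BigOperators
open Complex

noncomputable section

variable {P : Params} {n : ℕ}

/-! ## §1 The exponent of (5.6.6)–(5.6.7) is bounded through the printed kernel and field bounds -/

/-- **`|Ã_b| ≦ K₀M + W₀M′`** for `Ã = θ_kH_{k,loc}A^{(k)} + w₁A′` ((5.6.6)): row sums of `H_{k,loc}` `≦ K₀` ((2.5)), of `w₁` `≦ W₀` ((5.4.7)),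
`|A^{(k)}| ≦ M`, `|A′| ≦ M′` (small fields, `cp(e_k)`), `|θ_k| ≦ 1`. [cite: BalabanImbrieJaffe1988, (5.6.6) p.287] -/
theorem abs_tildeA_le {β β' : Type*} [Fintype β] [Fintype β'] {M M' K₀ W₀ : ℝ} {θ : PBond P n → ℝ} {K : PBond P n → β → ℝ}
    {A : β → ℝ} {W : PBond P n → β' → ℝ} {A' : β' → ℝ} (hθ : ∀ b, |θ b| ≤ 1) (hM : 0 ≤ M) (hA : ∀ b', |A b'| ≤ M)
    (hK₀ : ∀ b, ∑ b', |K b b'| ≤ K₀) (hM' : 0 ≤ M') (hA' : ∀ b', |A' b'| ≤ M') (hW₀ : ∀ b, ∑ b', |W b b'| ≤ W₀) (b : PBond P n) :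
    |θ b * (∑ b', K b b' * A b') + ∑ b', W b b' * A' b'| ≤ K₀ * M + W₀ * M' :=
  (abs_add_le _ _).trans (add_le_add
    ((abs_mul_le_of_abs_le_one (g := fun b => ∑ b', K b b' * A b') hθ b).trans (abs_kernel_apply_le hA (hK₀ b) hM))
    (abs_kernel_apply_le hA' (hW₀ b) hM'))

/-- **the exponent `a_b = ie_kηÃ_b` of `ũ = e^{ie_kηÃ}`** ((5.6.6); = `ie_jζÃ^ζ_b` of (5.6.7), the bond phase being scale invariant):
`‖a_b‖ ≦ e_kη·G` when `|Ã_b| ≦ G`, `e_kη ≧ 0`. [cite: BalabanImbrieJaffe1988, (5.6.7) p.287] -/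
theorem norm_expo_le {ekη G : ℝ} (hekη : 0 ≤ ekη) {At : PBond P n → ℝ} (hAt : ∀ b, |At b| ≤ G) (b : PBond P n) :
    ‖I * ((ekη * At b : ℝ) : ℂ)‖ ≤ ekη * G := by
  rw [norm_mul, Complex.norm_I, one_mul, Complex.norm_real, Real.norm_eq_abs, abs_mul, abs_of_nonneg hekη]
  exact mul_le_mul_of_nonneg_left (hAt b) hekη

/-- **the exponent `A(y,x) = ie_kηΣ_{b∈Γ_{y,x}}σ_bÃ_b` of the transporter `ũ(Γ^{(l)}_{y,x}) = Π_{b∈Γ}e^{±ie_kηÃ_b}`** ((5.6.8), `σ_b = ±1` the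
orientations): `‖A(y,x)‖ ≦ e_kη·N_Γ·G` for contours of at most `N_Γ` bonds. [cite: BalabanImbrieJaffe1988, (5.6.8) p.287] -/
theorem norm_contourExpo_le {ekη G : ℝ} {NΓ : ℕ} (hekη : 0 ≤ ekη) (hG : 0 ≤ G) {At σ : PBond P n → ℝ} (hAt : ∀ b, |At b| ≤ G)
    (hσ : ∀ b, |σ b| ≤ 1) {Γ : Finset (PBond P n)} (hΓ : Γ.card ≤ NΓ) :
    ‖I * ((ekη * ∑ b ∈ Γ, σ b * At b : ℝ) : ℂ)‖ ≤ ekη * NΓ * G := by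
  rw [norm_mul, Complex.norm_I, one_mul, Complex.norm_real, Real.norm_eq_abs, abs_mul, abs_of_nonneg hekη, mul_assoc]
  refine mul_le_mul_of_nonneg_left ?_ hekη
  calc |∑ b ∈ Γ, σ b * At b| ≤ ∑ b ∈ Γ, |σ b * At b| := Finset.abs_sum_le_sum_abs _ _
    _ ≤ ∑ b ∈ Γ, G := Finset.sum_le_sum fun b _ => by
        rw [abs_mul]
        calc |σ b| * |At b| ≤ 1 * G := mul_le_mul (hσ b) (hAt b) (abs_nonneg _) zero_le_one
          _ = G := one_mul G
    _ = Γ.card * G := by rw [Finset.sum_const, nsmul_eq_mul]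
    _ ≤ NΓ * G := mul_le_mul_of_nonneg_right (by exact_mod_cast hΓ) hG

/-! ## §2 The running charge (2.2): `e_kη ≦ e_jζ`, `e_j ≦ e_k`, `p(e_k) ≦ p(e_j)` -/

section Scales

variable {L ε e₀ : ℝ} {d : ℕ}

/-- **`e_kη ≦ e_jζ`** (`η = L^{−k}`, `ζ = L^{−j}`, `j ≦ k`): from (2.2) `e_j = e_k(L^{−(4−d)/2})^{k−j}` (p36's `eK_scale`) and
`L^{−1} ≦ L^{−(4−d)/2}` for `d ≧ 2`, `L ≧ 1` — the conversion *"Ã scaled to the ζ-lattice"* of (5.6.7) costs at most the factor `e_j/e_k·ζ/η`.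
[cite: BalabanImbrieJaffe1988, (2.2) p.260] -/
theorem eK_eta_le_eK_zeta (hL : 1 ≤ L) (hε : 0 < ε) (he₀ : 0 ≤ e₀) (hd : 2 ≤ d) {j k : ℕ} (hj : j ≤ k) :
    eK L ε e₀ d k * (L ^ k)⁻¹ ≤ eK L ε e₀ d j * (L ^ j)⁻¹ := by
  have hL0 : 0 < L := by linarith
  have hek : 0 ≤ eK L ε e₀ d k := by
    unfold eK; exact mul_nonneg (Real.rpow_nonneg (by positivity) _) he₀
  rw [eK_scale hL0 hε e₀ hj]
  -- `e_k L^{-k} ≤ e_k q^{k-j} L^{-j}` with `q = L^{-(4-d)/2} ≥ L^{-1}`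
  have hq : L ^ (-(1 : ℝ)) ≤ L ^ (-((4 - (d : ℝ)) / 2)) := by
    apply Real.rpow_le_rpow_of_exponent_le hL
    have : (2 : ℝ) ≤ d := by exact_mod_cast hd
    linarith
  have hq0 : 0 ≤ L ^ (-(1 : ℝ)) := Real.rpow_nonneg hL0.le _
  have hpow : (L ^ (-(1 : ℝ))) ^ (k - j) ≤ (L ^ (-((4 - (d : ℝ)) / 2))) ^ (k - j) := pow_le_pow_left₀ hq0 hq _
  have hLk : (L ^ k)⁻¹ = (L ^ (-(1 : ℝ))) ^ (k - j) * (L ^ j)⁻¹ := by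
    rw [Real.rpow_neg hL0.le, Real.rpow_one, inv_pow, ← mul_inv, ← pow_add, Nat.sub_add_cancel hj]
  rw [hLk, ← mul_assoc]
  exact mul_le_mul_of_nonneg_right (mul_le_mul_of_nonneg_left hpow hek) (by positivity)

/-- **`e_j ≦ e_k`** for `j ≦ k`, `d ≦ 4`, `L ≧ 1` (the running charge (2.2) grows with the scale below four dimensions).
[cite: BalabanImbrieJaffe1988, (2.2) p.260] -/
theorem eK_mono (hL : 1 ≤ L) (hε : 0 < ε) (he₀ : 0 ≤ e₀) (hd : d ≤ 4) {j k : ℕ} (hj : j ≤ k) :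
    eK L ε e₀ d j ≤ eK L ε e₀ d k := by
  have hL0 : 0 < L := by linarith
  have hek : 0 ≤ eK L ε e₀ d k := by
    unfold eK; exact mul_nonneg (Real.rpow_nonneg (by positivity) _) he₀
  rw [eK_scale hL0 hε e₀ hj]
  have hd' : (d : ℝ) ≤ 4 := by exact_mod_cast hd
  have hq1 : L ^ (-((4 - (d : ℝ)) / 2)) ≤ 1 := Real.rpow_le_one_of_one_le_of_nonpos hL (by linarith)
  have hq0 : 0 ≤ L ^ (-((4 - (d : ℝ)) / 2)) := Real.rpow_nonneg hL0.le _
  exact mul_le_of_le_one_right hek (pow_le_one₀ hq0 hq1)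

/-- **`p(e_k) ≦ p(e_j)`** for `0 < e_j ≦ e_k ≦ 1`, `p ≧ 0`: the logarithmic scale (2.33) `p(e) = |log e⁻¹|^p` is antitone on `(0,1]`, so a bound
`O(e_j·p(e_k))` is `O(e_j·p(e_j))`. [cite: BalabanImbrieJaffe1988, (2.33) p.263] -/
theorem pLog_anti {p ej ek : ℝ} (hp : 0 ≤ p) (hej : 0 < ej) (hjk : ej ≤ ek) (hek1 : ek ≤ 1) : pLog p ek ≤ pLog p ej := by
  unfold pLog
  have hk : 0 ≤ Real.log ek⁻¹ := Real.log_nonneg (one_le_inv₀ (hej.trans_le hjk) |>.mpr hek1)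
  have hmono : Real.log ek⁻¹ ≤ Real.log ej⁻¹ := by
    rw [Real.log_inv, Real.log_inv, neg_le_neg_iff]
    exact Real.log_le_log hej hjk
  rw [abs_of_nonneg hk, abs_of_nonneg (hk.trans hmono)]
  exact Real.rpow_le_rpow hk hmono hp

end Scales

/-! ## §3 The kernels of `V_j` are `O(e_j)`·(field bound) entrywise -/

/-- **`‖M(b,x)‖ ≦ 2e_j·G`** — the (5.6.9) kernel `M = c·u_b·F₁(a_b)·[x = b₊]` on the ζ-lattice (`c = ζ⁻¹`) with `a_b = ie_kηÃ_b`, `|Ã| ≦ G`,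
`|u_b| ≦ 1`, in the regime `e_kηG ≦ 1`, under the running-charge inequality `e_kη ≦ e_jζ`: the `ζ⁻¹` of the derivative is converted into `e_j`.
[cite: BalabanImbrieJaffe1988, (5.6.11) p.287] -/
theorem norm_mMat_le_scale {ek ej η ζ G : ℝ} (hek : 0 ≤ ek) (hη : 0 ≤ η) (hζ : 0 < ζ) (hscale : ek * η ≤ ej * ζ)
    {u : PBond P n → ℂ} (hu : ∀ b, ‖u b‖ ≤ 1) {At : PBond P n → ℝ} (hAt : ∀ b, |At b| ≤ G) (hsmall : ek * η * G ≤ 1)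
    (b : PBond P n) (x : Balaban1983to89.Site P n) :
    ‖mMat ζ⁻¹ u (fun b => I * ((ek * η * At b : ℝ) : ℂ)) b x‖ ≤ 2 * ej * G := by
  have hG : 0 ≤ G := (abs_nonneg _).trans (hAt b)
  have ha : ∀ b', ‖I * ((ek * η * At b' : ℝ) : ℂ)‖ ≤ ek * η * G := fun b' => norm_expo_le (mul_nonneg hek hη) hAt b'
  calc ‖mMat ζ⁻¹ u (fun b => I * ((ek * η * At b : ℝ) : ℂ)) b x‖ ≤ |ζ⁻¹| * (2 * (ek * η * G)) := norm_mMat_le (hu b) (ha b) hsmall x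
    _ = 2 * (ζ⁻¹ * (ek * η)) * G := by rw [abs_of_pos (inv_pos.mpr hζ)]; ring
    _ ≤ 2 * ej * G := by
        refine mul_le_mul_of_nonneg_right (mul_le_mul_of_nonneg_left ?_ zero_le_two) hG
        rw [inv_mul_le_iff₀ hζ, mul_comm ζ]
        exact hscale

/-- **`‖F₂(y,x)‖ ≦ 2|w|·(e_kηN_Γ)·G ≦ 2d|w|·e_j·G`** — the (5.6.8) kernel `F₂ = w·U(y,x)·F₁(A(y,x))·[x ∈ B(y)]` with the transporter exponent
`A(y,x) = ie_kηΣ_{b∈Γ_{y,x}}σ_bÃ_b`, `|σ| ≦ 1`, contours of `≦ N_Γ` bonds with `N_Γ ≦ d·ζ⁻¹` (`= dL^j`, a staircase across the block), `|U| ≦ 1`,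
`|Ã| ≦ G`, regime `e_kηN_ΓG ≦ 1`, running charge `e_kη ≦ e_jζ`. [cite: BalabanImbrieJaffe1988, (5.6.11) p.287] -/
theorem norm_f2Mat_le_scale {α τ : Type*} [Fintype α] [DecidableEq α] {ek ej η ζ G dd : ℝ} {NΓ : ℕ} (hek : 0 ≤ ek) (hη : 0 ≤ η)
    (hζ : 0 < ζ) (hscale : ek * η ≤ ej * ζ) (hNΓ : (NΓ : ℝ) ≤ dd * ζ⁻¹) {B : τ → Finset α} {w : ℝ} {U : τ → α → ℂ}
    (hU : ∀ y x, ‖U y x‖ ≤ 1) (hG : 0 ≤ G) {At : PBond P n → ℝ} (hAt : ∀ b, |At b| ≤ G) {σ : τ → α → PBond P n → ℝ}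
    (hσ : ∀ y x b, |σ y x b| ≤ 1) {Γ : τ → α → Finset (PBond P n)} (hΓ : ∀ y x, (Γ y x).card ≤ NΓ) (hsmall : ek * η * NΓ * G ≤ 1)
    (y : τ) (x : α) :
    ‖f2Mat B w U (fun y x => I * ((ek * η * ∑ b ∈ Γ y x, σ y x b * At b : ℝ) : ℂ)) y x‖ ≤ |w| * (2 * dd * ej * G) := by
  have hA : ∀ y x, ‖I * ((ek * η * ∑ b ∈ Γ y x, σ y x b * At b : ℝ) : ℂ)‖ ≤ ek * η * NΓ * G :=
    fun y x => norm_contourExpo_le (mul_nonneg hek hη) hG hAt (hσ y x) (hΓ y x)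
  have h1 := norm_f2Mat_le (B := B) (w := w) (A := fun y x => I * ((ek * η * ∑ b ∈ Γ y x, σ y x b * At b : ℝ) : ℂ))
    (hU y x) (hA y x) hsmall
  refine h1.trans (mul_le_mul_of_nonneg_left ?_ (abs_nonneg w))
  -- `2 (e_kη N_Γ) G ≤ 2 d e_j G`
  have hkey : ek * η * NΓ ≤ dd * ej := by
    calc ek * η * NΓ ≤ ek * η * (dd * ζ⁻¹) := mul_le_mul_of_nonneg_left hNΓ (mul_nonneg hek hη)
      _ = dd * (ζ⁻¹ * (ek * η)) := by ring
      _ ≤ dd * ej := by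
          have hdd : 0 ≤ dd := by
            have : (0 : ℝ) ≤ dd * ζ⁻¹ := (Nat.cast_nonneg NΓ).trans hNΓ
            exact nonneg_of_mul_nonneg_left (by simpa [mul_comm] using this) (inv_pos.mpr hζ)
          refine mul_le_mul_of_nonneg_left ?_ hdd
          rw [inv_mul_le_iff₀ hζ, mul_comm ζ]
          exact hscale
  nlinarith

/-- **`‖M(b,x)‖ ≦ 2e_j(K₀M + W₀M′)` with the charges and spacings of record** — `e_k = eK … k`, `e_j = eK … j` (p36/r18's (2.2)), `η = L^{−k}`,
`ζ = L^{−j}`, `j ≦ k`, `2 ≦ d`, `1 ≦ L`; `Ã = θ_kH_{k,loc}A^{(k)} + w₁A′` with the kernel/field bounds of §1.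
[cite: BalabanImbrieJaffe1988, (5.6.11) p.287] -/
theorem norm_mMat_le_eK {β β' : Type*} [Fintype β] [Fintype β'] {L ε e₀ M M' K₀ W₀ : ℝ} {d j k : ℕ} (hL : 1 ≤ L) (hε : 0 < ε)
    (he₀ : 0 ≤ e₀) (hd : 2 ≤ d) (hj : j ≤ k) {θ : PBond P n → ℝ} {K : PBond P n → β → ℝ} {A : β → ℝ} {W : PBond P n → β' → ℝ}
    {A' : β' → ℝ} (hθ : ∀ b, |θ b| ≤ 1) (hM : 0 ≤ M) (hA : ∀ b', |A b'| ≤ M) (hK₀ : ∀ b, ∑ b', |K b b'| ≤ K₀) (hM' : 0 ≤ M')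
    (hA' : ∀ b', |A' b'| ≤ M') (hW₀ : ∀ b, ∑ b', |W b b'| ≤ W₀) {u : PBond P n → ℂ} (hu : ∀ b, ‖u b‖ ≤ 1)
    (hsmall : eK L ε e₀ d k * (L ^ k)⁻¹ * (K₀ * M + W₀ * M') ≤ 1) (b : PBond P n) (x : Balaban1983to89.Site P n) :
    ‖mMat ((L ^ j)⁻¹)⁻¹ u (fun b => I * ((eK L ε e₀ d k * (L ^ k)⁻¹ *
        (θ b * (∑ b', K b b' * A b') + ∑ b', W b b' * A' b') : ℝ) : ℂ)) b x‖ ≤ 2 * eK L ε e₀ d j * (K₀ * M + W₀ * M') := by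
  have hL0 : 0 < L := by linarith
  have hek : 0 ≤ eK L ε e₀ d k := by
    unfold eK; exact mul_nonneg (Real.rpow_nonneg (by positivity) _) he₀
  exact norm_mMat_le_scale hek (by positivity) (by positivity) (eK_eta_le_eK_zeta hL hε he₀ hd hj) hu
    (abs_tildeA_le hθ hM hA hK₀ hM' hA' hW₀) hsmall b x

/-- **the printed size `O(e_j^{1−α})`**: with `M = c·p(e_k)`, `M′ = c′·p(e_k)` (small fields in the logarithmic scale (2.33)) and `e_j ≦ e_k ≦ 1`
(so `p(e_k) ≦ p(e_j)`), `‖M(b,x)‖ ≦ 2(K₀c + W₀c′)·e_j·p(e_j)` — `O(e_jp(e_j))`, print's `O(e_j^{1−α})`. [cite: BalabanImbrieJaffe1988, (5.6.11) p.287] -/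
theorem norm_mMat_le_printedScale {ek ej η ζ p c c' K₀ W₀ : ℝ} (hej : 0 < ej) (hjk : ej ≤ ek) (hek1 : ek ≤ 1) (hp : 0 ≤ p)
    (hη : 0 ≤ η) (hζ : 0 < ζ) (hscale : ek * η ≤ ej * ζ) (hc : 0 ≤ c) (hc' : 0 ≤ c') (hK₀ : 0 ≤ K₀) (hW₀ : 0 ≤ W₀)
    {u : PBond P n → ℂ} (hu : ∀ b, ‖u b‖ ≤ 1) {At : PBond P n → ℝ} (hAt : ∀ b, |At b| ≤ K₀ * (c * pLog p ek) + W₀ * (c' * pLog p ek))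
    (hsmall : ek * η * (K₀ * (c * pLog p ek) + W₀ * (c' * pLog p ek)) ≤ 1) (b : PBond P n) (x : Balaban1983to89.Site P n) :
    ‖mMat ζ⁻¹ u (fun b => I * ((ek * η * At b : ℝ) : ℂ)) b x‖ ≤ 2 * (K₀ * c + W₀ * c') * (ej * pLog p ej) := by
  have h1 := norm_mMat_le_scale (hej.le.trans hjk) hη hζ hscale hu hAt hsmall b x
  have hpl : pLog p ek ≤ pLog p ej := pLog_anti hp hej hjk hek1
  have hpl0 : 0 ≤ pLog p ek := by unfold pLog; positivity
  calc ‖mMat ζ⁻¹ u (fun b => I * ((ek * η * At b : ℝ) : ℂ)) b x‖ ≤ 2 * ej * (K₀ * (c * pLog p ek) + W₀ * (c' * pLog p ek)) := h1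
    _ = 2 * (K₀ * c + W₀ * c') * (ej * pLog p ek) := by ring
    _ ≤ 2 * (K₀ * c + W₀ * c') * (ej * pLog p ej) := by
        have : 0 ≤ 2 * (K₀ * c + W₀ * c') := by positivity
        exact mul_le_mul_of_nonneg_left (mul_le_mul_of_nonneg_left hpl hej.le) this

end

end Literature.MathematicalPhysics.QuantumFieldTheory.BalabanImbrieJaffe1984to88.BIJ88VjSmall287
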